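import Mathlib
import Summits.PneNP.PneNP.Theorems.PstarFibrePolys
import Summits.PneNP.PneNP.Theorems.PstarGraphQuadGap
import Summits.PneNP.PneNP.Theorems.PstarProductRank
import Summits.PneNP.PneNP.Theorems.PstarGraphQuadGapOne
import Summits.PneNP.PneNP.Theorems.PstarGraphQuadGapTwoForms
import Summits.PneNP.PneNP.Theorems.PstarGraphQuadGapTwoCases

/-!
# Two quadratic constraints: `PstarGraphQuadGap.GraphQuadGapTwo` by name (ROUND-24 item T24.11c, part II)

FRONTIER range-avoidance ladder, rung F-N3, ROUND 24 (cell `pnp-ideate`; the second proved case of the graph-quadratic gap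
conjecture `PstarGraphQuadGap.GraphQuadGap`, the XOR-disjoint core of the crux `PstarGapLemma.PstarGapLemmaSO` — restricted-model
proof complexity, nothing here bears on `P` versus `NP`).

**Statement.** An unsat, edge-minimal graph-quadratic system `W` on a simple graph `E` of maximum degree `Δ` with at most TWO
genuinely quadratic constraints has `|E| ≤ 4Δ² · |W|`.

**Proof** = bookkeeping around `PstarGraphQuadGapTwoCases.two_forms_bound`.  With `≤ 1` quadratic constraint this is
`PstarGraphQuadGapOne.graphQuadGapOne`.  Otherwise the two quadratic constraints are `w_i = (T_i, S_i, c_i)`, `T_i ⊆ E`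
(`Supported`); the `|W| − 2` affine constraints cut out the coset `b₀ + ker Φ` of codimension `≤ |W| − 2` (`Φ x = (Σ_{v∈S_w} x_v)_w`,
`b₀ = bit ∘ a₀` for an edge-minimality witness `a₀`, rank–nullity), every point of which is the `bit`-image of a Boolean assignment
satisfying all affine constraints (`𝔽₂ ↔ Bool` bridge `PstarGraphQuadGapOne.bit_qval`); so `Unsat` and `EdgeMinimal` translate into
the hypotheses of `two_forms_bound` for `f_i = qform T_i + L_{S_i} + bit c_i`, which returns `|E| ≤ 2Δ²(2(|W|−2)+3) ≤ 4Δ²|W|`.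
-/

set_option linter.dupNamespace false -- `Summit.PneNP.PneNP.…`: summit = sub-problem name (D-0017 single-conjunct layout)

open Finset Module
open Summit.PneNP.PneNP.Theorems.PstarFibrePolys (bit bit_injective)
open Summit.PneNP.PneNP.Theorems.PstarProductRank
open Summit.PneNP.PneNP.Theorems.PstarGraphQuadGap
open Summit.PneNP.PneNP.Theorems.PstarGraphQuadGapOne (bit_qval graphQuadGapOne)
open Summit.PneNP.PneNP.Theorems.PstarGraphQuadGapTwoCases (two_forms_bound)

namespace Summit.PneNP.PneNP.Theorems.PstarGraphQuadGapTwo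

/-- In `𝔽₂`, `x + x = 0`. -/
private theorem zmod2_add_self (x : ZMod 2) : x + x = 0 := by
  revert x; decide

/-- Reading a bit back from `𝔽₂`. -/
private theorem bit_decide_eq_one (t : ZMod 2) : bit (decide (t = 1)) = t := by
  revert t; decide

/-- The `𝔽₂` form of a graph-quadratic constraint: `(T,S,c)` holds at `a` iff `qform T (bit ∘ a) + Σ_S bit (a v) + bit c = 0`. -/
theorem qholds_iff {V : ℕ} (w : QCon V) (a : Fin V → Bool) :
    QHolds w a ↔ qform w.1 Prod.fst Prod.snd (fun v => bit (a v)) + ∑ v ∈ w.2.1, bit (a v) + bit w.2.2 = 0 := by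
  unfold QHolds
  rw [← bit_injective.eq_iff, bit_qval]
  have hc := zmod2_add_self (bit w.2.2)
  constructor
  · intro h; rw [h]; exact hc
  · intro h; linear_combination h - hc

/-- **T24.11c — `GraphQuadGapTwo` by name.**  An unsat, edge-minimal graph-quadratic system on a simple graph of maximum degree
`Δ` with at most two genuinely quadratic constraints has `|E| ≤ 4Δ² · |W|` (bias identity + Lagrangian subspaces + greedy induced
matching).  FRONTIER; nothing here bears on `P` versus `NP`. -/
theorem graphQuadGapTwo : GraphQuadGapTwo := by
  classical
  intro Δ V E W hS hΔ hsupp hU hM hq2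
  by_cases hq1 : quadCount W ≤ 1
  · refine (graphQuadGapOne Δ V E W hS hΔ hsupp hU hM hq1).trans ?_
    exact Nat.mul_le_mul_right _ (Nat.mul_le_mul_right _ (by norm_num))
  have hq : quadCount W = 2 := by omega
  unfold quadCount at hq
  obtain ⟨w₁, w₂, hne, hpair⟩ := card_eq_two.1 hq
  have hw₁ : w₁ ∈ W ∧ w₁.1 ≠ ∅ := by
    have : w₁ ∈ W.filter (fun w => w.1 ≠ ∅) := by rw [hpair]; simp
    exact mem_filter.1 this
  have hw₂ : w₂ ∈ W ∧ w₂.1 ≠ ∅ := by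
    have : w₂ ∈ W.filter (fun w => w.1 ≠ ∅) := by rw [hpair]; simp
    exact mem_filter.1 this
  have haff : ∀ w ∈ W, w ≠ w₁ → w ≠ w₂ → w.1 = ∅ := by
    intro w hw h1 h2
    by_contra hT
    have : w ∈ W.filter (fun w => w.1 ≠ ∅) := mem_filter.2 ⟨hw, hT⟩
    rw [hpair, mem_insert, mem_singleton] at this
    rcases this with h | h
    exacts [h1 h, h2 h]
  have hW2 : 2 ≤ W.card := by
    rw [← hq]; exact card_filter_le _ _
  rcases E.eq_empty_or_nonempty with rfl | ⟨j₀, hj₀⟩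
  · simp
  -- base witness, `𝔽₂` base point
  obtain ⟨a₀, ha₀⟩ := hM j₀ hj₀
  have ha₀aff : ∀ w ∈ W, w ≠ w₁ → w ≠ w₂ → QHolds w a₀ := fun w hw h1 h2 =>
    (ha₀ w hw).2 (by rw [haff w hw h1 h2]; exact notMem_empty _)
  obtain ⟨b₀, hb₀⟩ : ∃ b₀ : Fin V → ZMod 2, ∀ v, b₀ v = bit (a₀ v) := ⟨_, fun _ => rfl⟩
  -- the affine constraints as a linear map `Φ`
  obtain ⟨Φ, hΦ⟩ : ∃ Φ : (Fin V → ZMod 2) →ₗ[ZMod 2] (↥((W.erase w₁).erase w₂) → ZMod 2),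
      ∀ (x : Fin V → ZMod 2) (w : ↥((W.erase w₁).erase w₂)), Φ x w = ∑ v ∈ (w : QCon V).2.1, x v :=
    ⟨LinearMap.pi fun w : ↥((W.erase w₁).erase w₂) => ∑ v ∈ (w : QCon V).2.1, LinearMap.proj v, fun x w => by
      rw [LinearMap.pi_apply, LinearMap.sum_apply]; rfl⟩
  have hmemker : ∀ x : Fin V → ZMod 2,
      x ∈ LinearMap.ker Φ ↔ ∀ w ∈ W, w ≠ w₁ → w ≠ w₂ → ∑ v ∈ w.2.1, x v = 0 := by
    intro x
    rw [LinearMap.mem_ker]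
    constructor
    · intro hx w hw h1 h2
      have := congrFun hx ⟨w, mem_erase.2 ⟨h2, mem_erase.2 ⟨h1, hw⟩⟩⟩
      rwa [hΦ] at this
    · intro h
      funext w
      rw [hΦ, Pi.zero_apply]
      obtain ⟨hw2, hw'⟩ := mem_erase.1 w.2
      obtain ⟨hw1, hwW⟩ := mem_erase.1 hw'
      exact h _ hwW hw1 hw2
  -- the two quadratic functions
  obtain ⟨L₁, hL₁⟩ : ∃ L : (Fin V → ZMod 2) →ₗ[ZMod 2] ZMod 2, ∀ x, L x = ∑ v ∈ w₁.2.1, x v :=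
    ⟨∑ v ∈ w₁.2.1, LinearMap.proj v, fun x => by rw [LinearMap.sum_apply]; rfl⟩
  obtain ⟨L₂, hL₂⟩ : ∃ L : (Fin V → ZMod 2) →ₗ[ZMod 2] ZMod 2, ∀ x, L x = ∑ v ∈ w₂.2.1, x v :=
    ⟨∑ v ∈ w₂.2.1, LinearMap.proj v, fun x => by rw [LinearMap.sum_apply]; rfl⟩
  obtain ⟨f₁, hf₁⟩ : ∃ f : (Fin V → ZMod 2) → ZMod 2,
      ∀ x, f x = qform w₁.1 Prod.fst Prod.snd x + L₁ x + bit w₁.2.2 := ⟨_, fun _ => rfl⟩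
  obtain ⟨f₂, hf₂⟩ : ∃ f : (Fin V → ZMod 2) → ZMod 2,
      ∀ x, f x = qform w₂.1 Prod.fst Prod.snd x + L₂ x + bit w₂.2.2 := ⟨_, fun _ => rfl⟩
  -- evaluation of `f_i` at the image of a Boolean assignment
  have hf_eval : ∀ (u : Fin V → ZMod 2) (a : Fin V → Bool), (∀ v, bit (a v) = b₀ v + u v) →
      (f₁ (b₀ + u) = 0 ↔ QHolds w₁ a) ∧ (f₂ (b₀ + u) = 0 ↔ QHolds w₂ a) := by
    intro u a ha
    have hfun : (fun v => bit (a v)) = b₀ + u := funext fun v => by rw [ha v, Pi.add_apply]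
    have e1 : f₁ (b₀ + u) = qform w₁.1 Prod.fst Prod.snd (fun v => bit (a v)) + ∑ v ∈ w₁.2.1, bit (a v) + bit w₁.2.2 := by
      rw [hfun, hf₁, hL₁]; try simp only [Pi.add_apply, ha]
    have e2 : f₂ (b₀ + u) = qform w₂.1 Prod.fst Prod.snd (fun v => bit (a v)) + ∑ v ∈ w₂.2.1, bit (a v) + bit w₂.2.2 := by
      rw [hfun, hf₂, hL₂]; try simp only [Pi.add_apply, ha]
    rw [qholds_iff, qholds_iff, e1, e2]
    exact ⟨Iff.rfl, Iff.rfl⟩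
  -- pull-back: every point of the coset is the image of an assignment satisfying the affine constraints
  have hpull : ∀ u ∈ LinearMap.ker Φ, ∃ a : Fin V → Bool, (∀ v, bit (a v) = b₀ v + u v) ∧
      ∀ w ∈ W, w ≠ w₁ → w ≠ w₂ → QHolds w a := by
    intro u hu
    refine ⟨fun v => decide (b₀ v + u v = 1), fun v => bit_decide_eq_one _, fun w hw h1 h2 => ?_⟩
    have e0 := (qholds_iff w a₀).1 (ha₀aff w hw h1 h2)
    rw [haff w hw h1 h2] at e0
    simp only [qform, sum_empty, zero_add] at e0
    rw [qholds_iff, haff w hw h1 h2]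
    simp only [qform, sum_empty, zero_add, bit_decide_eq_one, sum_add_distrib, (hmemker u).1 hu w hw h1 h2, add_zero, hb₀]
    exact e0
  -- unsat and edge-minimality on the coset
  have hunsat : ∀ u ∈ LinearMap.ker Φ, f₁ (b₀ + u) ≠ 0 ∨ f₂ (b₀ + u) ≠ 0 := by
    intro u hu
    obtain ⟨a, ha, haff_a⟩ := hpull u hu
    obtain ⟨e1, e2⟩ := hf_eval u a ha
    by_contra h
    push Not at h
    refine hU ⟨a, fun w hw => ?_⟩
    by_cases h1 : w = w₁
    · rw [h1]; exact e1.1 h.1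
    by_cases h2 : w = w₂
    · rw [h2]; exact e2.1 h.2
    exact haff_a w hw h1 h2
  have hmin : ∀ j ∈ E, ∃ u ∈ LinearMap.ker Φ, (f₁ (b₀ + u) = 0 ↔ j ∉ w₁.1) ∧ (f₂ (b₀ + u) = 0 ↔ j ∉ w₂.1) := by
    intro j hj
    obtain ⟨a, ha⟩ := hM j hj
    have ha' : ∀ v, bit (a v) = b₀ v + ((fun v => bit (a v)) - b₀) v := fun v => by simp
    refine ⟨(fun v => bit (a v)) - b₀, ?_, ?_⟩
    · rw [hmemker]
      intro w hw h1 h2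
      have ea := (qholds_iff w a).1 ((ha w hw).2 (by rw [haff w hw h1 h2]; exact notMem_empty _))
      have e0 := (qholds_iff w a₀).1 (ha₀aff w hw h1 h2)
      rw [haff w hw h1 h2] at ea e0
      simp only [qform, sum_empty, zero_add] at ea e0
      simp only [Pi.sub_apply, sum_sub_distrib, hb₀]
      linear_combination ea - e0
    · obtain ⟨e1, e2⟩ := hf_eval _ a ha'
      exact ⟨e1.trans (ha w₁ hw₁.1), e2.trans (ha w₂ hw₂.1)⟩
  -- codimension of the coset
  have hcodim : V ≤ finrank (ZMod 2) (LinearMap.ker Φ) + (W.card - 2) := by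
    have hrank := LinearMap.finrank_range_add_finrank_ker Φ
    have hrange : finrank (ZMod 2) (LinearMap.range Φ) ≤ ((W.erase w₁).erase w₂).card := by
      calc _ ≤ finrank (ZMod 2) (↥((W.erase w₁).erase w₂) → ZMod 2) := Submodule.finrank_le _
        _ = ((W.erase w₁).erase w₂).card := by rw [Module.finrank_pi, Fintype.card_coe]
    have hc : ((W.erase w₁).erase w₂).card + 2 = W.card := by
      rw [card_erase_of_mem (mem_erase.2 ⟨hne.symm, hw₂.1⟩), card_erase_of_mem hw₁.1]
      omega
    have hN : finrank (ZMod 2) (Fin V → ZMod 2) = V := by simp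
    omega
  -- the two-forms bound
  have hmain := two_forms_bound (t := W.card - 2) hS hΔ (hsupp w₁ hw₁.1) (hsupp w₂ hw₂.1) hcodim hf₁ hf₂ hunsat hmin
  calc E.card ≤ 2 * Δ ^ 2 * (2 * (W.card - 2) + 3) := hmain
    _ ≤ 2 * Δ ^ 2 * (2 * W.card) := Nat.mul_le_mul_left _ (by omega)
    _ = 4 * Δ ^ 2 * W.card := by ring

end Summit.PneNP.PneNP.Theorems.PstarGraphQuadGapTwo
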